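import Summits.QuantumAdvantage.QuantumAdvantage.Theorems.CharDialTokenDialP1
import Summits.QuantumAdvantage.QuantumAdvantage.Theorems.CharDialTokenDialM
import HarnessLib

/-!
# WalkHardFJLinOdd — the token dial, part P: the far-reader flip dial ABSORBED into the log-budget split of `T`, by name

Cell `decomp-qadv`, lens 6, generation 19 (REV4 «FarFlipDial»).  (1) the pieces `ResidualHighFarSide B`, `LowResidualFarSide B`,
`ResidualFarSide` = the log-budget pieces of part M with the TENTH escape clause `¬ FarFlipHyp p (dialB n) (dialB n) (farL n) y`;
(2) the tenth escape clause costs nothing: each log-budget piece is EQUIVALENT to its far residual (`farFlip_hard_log`, part P1,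
absorbed with `θ := max θ_far (1 − 1/(48p))`), hence the filed items are, BY NAME, `JLinLowResidual5 ⟺ LowResidualFarSide dialB`
(item 27206) and `JLinResidualHigh5 ⟺ ResidualHighFarSide dialB` (item 27207), and `T ⟺ ResidualFarSide`;
(3) `fieldY` escapes the far dial too (more than `dialB n` moving cuts at every adjacency, `field_not_farFlip`), so
class(RESIDUAL-HIGH-FAR) is inhabited and the HIGH residual is tested non-vacuously.
-/

set_option autoImplicit false

open Finset

namespace Summit.QuantumAdvantage.AdviceFreeQNC0.JLinPeel

namespace TowerDefs

variable {n : ℕ}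

/-- **piece RESIDUAL-HIGH-FAR.** `ResidualHighLogSide` with the escape clause `¬ FarFlipHyp p (dialB n) (dialB n) (farL n) y`. -/
def ResidualHighFarSide (B : ℕ → ℕ) : Prop :=
  ∀ (p : ℕ) [Fact p.Prime], 5 ≤ p → ∃ θ : ℝ, θ < 1 ∧ ∃ n₀ : ℕ, ∀ n ≥ n₀, ∀ c : ℕ,
    ∀ y : Fin (n + 1) → (Fin n → Bool) → Bool, JLinHyp p n y → ¬ LowVar B n y → ¬ FlipHyp p (dialB n) (dialB n) y →
      ¬ FarFlipHyp p (dialB n) (dialB n) (farL n) y →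
      (∀ D : JLinPeel.JLinData p n, D.strat = y → (∀ g, (D.J g).card ≤ Nat.log 2 n) →
          ¬ SpanHyp D ∧ ¬ SparseHyp D ∧ ¬ BlockHyp D ∧ ¬ NullHyp D ∧ ¬ MaskHyp D) →
        ((Finset.univ.filter fun u : Fin n → Bool => ringWinU c y u = true).card : ℝ) ≤ θ * (2 : ℝ) ^ n

/-- **piece LOW-RESIDUAL-FAR.** `LowResidualLogSide` with the escape clause `¬ FarFlipHyp p (dialB n) (dialB n) (farL n) y`. -/
def LowResidualFarSide (B : ℕ → ℕ) : Prop :=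
  ∀ (p : ℕ) [Fact p.Prime], 5 ≤ p → ∃ θ : ℝ, θ < 1 ∧ ∃ n₀ : ℕ, ∀ n ≥ n₀, ∀ c : ℕ,
    ∀ y : Fin (n + 1) → (Fin n → Bool) → Bool, JLinHyp p n y → LowVar B n y → ¬ FlipHyp p (dialB n) (dialB n) y →
      ¬ FarFlipHyp p (dialB n) (dialB n) (farL n) y →
      (∀ D : JLinPeel.JLinData p n, D.strat = y → (∀ g, (D.J g).card ≤ Nat.log 2 n) →
          ¬ SpanHyp D ∧ ¬ SparseHyp D ∧ ¬ BlockHyp D ∧ ¬ NullHyp D ∧ ¬ MaskHyp D) →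
        ((Finset.univ.filter fun u : Fin n → Bool => ringWinU c y u = true).card : ℝ) ≤ θ * (2 : ℝ) ^ n

/-- **the FAR RESIDUAL of T** (no variation condition). -/
def ResidualFarSide : Prop :=
  ∀ (p : ℕ) [Fact p.Prime], 5 ≤ p → ∃ θ : ℝ, θ < 1 ∧ ∃ n₀ : ℕ, ∀ n ≥ n₀, ∀ c : ℕ,
    ∀ y : Fin (n + 1) → (Fin n → Bool) → Bool, JLinHyp p n y → ¬ FlipHyp p (dialB n) (dialB n) y →
      ¬ FarFlipHyp p (dialB n) (dialB n) (farL n) y →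
      (∀ D : JLinPeel.JLinData p n, D.strat = y → (∀ g, (D.J g).card ≤ Nat.log 2 n) →
          ¬ SpanHyp D ∧ ¬ SparseHyp D ∧ ¬ BlockHyp D ∧ ¬ NullHyp D ∧ ¬ MaskHyp D) →
        ((Finset.univ.filter fun u : Fin n → Bool => ringWinU c y u = true).card : ℝ) ≤ θ * (2 : ℝ) ^ n

end TowerDefs

namespace TokenDial

open SegMove

variable {n : ℕ}

section FarPieces

variable {p : ℕ} [hp : Fact p.Prime]

/-! ### (1) class-FAR ⊆ class-LOG: the log-budget pieces give the far pieces -/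

omit hp in
/-- RESIDUAL-LOG gives RESIDUAL-FAR. -/
theorem residualFar_of_residualLog : TowerDefs.ResidualLogSide → TowerDefs.ResidualFarSide := by
  intro h p _ hp5
  obtain ⟨θ, hθ, n₀, hn₀⟩ := h p hp5
  exact ⟨θ, hθ, n₀, fun n hn c y hy hF _ hesc => hn₀ n hn c y hy hF hesc⟩

omit hp in
/-- LOW-RESIDUAL-LOG gives LOW-RESIDUAL-FAR. -/
theorem lowResidualFar_of_lowResidualLog (B : ℕ → ℕ) : TowerDefs.LowResidualLogSide B → TowerDefs.LowResidualFarSide B := by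
  intro h p _ hp5
  obtain ⟨θ, hθ, n₀, hn₀⟩ := h p hp5
  exact ⟨θ, hθ, n₀, fun n hn c y hy hV hF _ hesc => hn₀ n hn c y hy hV hF hesc⟩

omit hp in
/-- RESIDUAL-HIGH-LOG gives RESIDUAL-HIGH-FAR. -/
theorem residualHighFar_of_residualHighLog (B : ℕ → ℕ) :
    TowerDefs.ResidualHighLogSide B → TowerDefs.ResidualHighFarSide B := by
  intro h p _ hp5
  obtain ⟨θ, hθ, n₀, hn₀⟩ := h p hp5
  exact ⟨θ, hθ, n₀, fun n hn c y hy hV hF _ hesc => hn₀ n hn c y hy hV hF hesc⟩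

/-! ### (2) the tenth escape clause costs nothing -/

omit hp in
/-- **absorbing the far dial at log budget** (the common step): under a side condition `V`, the far piece gives the log-budget piece,
`θ := max θ_far (1 − 1/(48p))`; a strategy meeting `FarFlipHyp p (dialB n) (dialB n) (farL n)` is PRESENTED (by choice from `JLinHyp`)
and handed to `farFlip_hard_log`. -/
theorem absorb_farLog (V : (p n : ℕ) → (Fin (n + 1) → (Fin n → Bool) → Bool) → Prop)
    (h10 : ∀ (p : ℕ) [Fact p.Prime], 5 ≤ p → ∃ θ : ℝ, θ < 1 ∧ ∃ n₀ : ℕ, ∀ n ≥ n₀, ∀ c : ℕ,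
      ∀ y : Fin (n + 1) → (Fin n → Bool) → Bool, TowerDefs.JLinHyp p n y → V p n y →
        ¬ TowerDefs.FlipHyp p (TowerDefs.dialB n) (TowerDefs.dialB n) y →
        ¬ TowerDefs.FarFlipHyp p (TowerDefs.dialB n) (TowerDefs.dialB n) (TowerDefs.farL n) y →
        (∀ D : JLinPeel.JLinData p n, D.strat = y → (∀ g, (D.J g).card ≤ Nat.log 2 n) →
            ¬ TowerDefs.SpanHyp D ∧ ¬ TowerDefs.SparseHyp D ∧ ¬ TowerDefs.BlockHyp D ∧ ¬ TowerDefs.NullHyp D ∧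
              ¬ TowerDefs.MaskHyp D) →
          ((Finset.univ.filter fun u : Fin n → Bool => ringWinU c y u = true).card : ℝ) ≤ θ * (2 : ℝ) ^ n) :
    ∀ (p : ℕ) [Fact p.Prime], 5 ≤ p → ∃ θ : ℝ, θ < 1 ∧ ∃ n₀ : ℕ, ∀ n ≥ n₀, ∀ c : ℕ,
      ∀ y : Fin (n + 1) → (Fin n → Bool) → Bool, TowerDefs.JLinHyp p n y → V p n y →
        ¬ TowerDefs.FlipHyp p (TowerDefs.dialB n) (TowerDefs.dialB n) y →
        (∀ D : JLinPeel.JLinData p n, D.strat = y → (∀ g, (D.J g).card ≤ Nat.log 2 n) →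
            ¬ TowerDefs.SpanHyp D ∧ ¬ TowerDefs.SparseHyp D ∧ ¬ TowerDefs.BlockHyp D ∧ ¬ TowerDefs.NullHyp D ∧
              ¬ TowerDefs.MaskHyp D) →
          ((Finset.univ.filter fun u : Fin n → Bool => ringWinU c y u = true).card : ℝ) ≤ θ * (2 : ℝ) ^ n := by
  intro p _ hp5
  have hp3 : p ≠ 3 := by omega
  obtain ⟨θ, hθ, n₉, hn₉⟩ := h10 p hp5
  obtain ⟨n₁, hn₁⟩ := farFlip_hard_log (p := p) hp3
  have hpR : (0 : ℝ) < p := by exact_mod_cast (show 0 < p by omega)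
  have hθ' : (1 : ℝ) - 1 / (48 * p) < 1 := by
    have : (0 : ℝ) < 1 / (48 * p) := by positivity
    linarith
  refine ⟨max θ (1 - 1 / (48 * p)), max_lt hθ hθ', max n₉ n₁, fun n hn c y hy hV hF hesc => ?_⟩
  have h2n : (0 : ℝ) ≤ (2 : ℝ) ^ n := by positivity
  by_cases hfl : TowerDefs.FarFlipHyp p (TowerDefs.dialB n) (TowerDefs.dialB n) (TowerDefs.farL n) y
  · have hy' := hy
    unfold TowerDefs.JLinHyp at hy'
    choose J hJ a h hdep hrep using hy'
    let D : JLinPeel.JLinData p n := ⟨J, a, h, fun g u v huv s => hdep g u v huv s⟩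
    have hD : D.strat = y := by
      funext g u
      exact (hrep g u).symm
    have hfl' : TowerDefs.FarFlipHyp p (TowerDefs.dialB n) (TowerDefs.dialB n) (TowerDefs.farL n) D.strat := by
      rw [hD]; exact hfl
    have h := hn₁ n (le_trans (le_max_right _ _) hn) c D hJ hfl'
    rw [hD] at h
    exact h.trans (mul_le_mul_of_nonneg_right (le_max_right _ _) h2n)
  · have h := hn₉ n (le_trans (le_max_left _ _) hn) c y hy hV hF hfl hesc
    exact h.trans (mul_le_mul_of_nonneg_right (le_max_left _ _) h2n)

omit hp in
/-- ★ the far residual gives the log-budget residual (far dial absorbed). -/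
theorem residualLog_of_residualFar : TowerDefs.ResidualFarSide → TowerDefs.ResidualLogSide := by
  intro h10
  have h := absorb_farLog (fun _ _ _ => True) (fun p _ hp5 => by
    obtain ⟨θ, hθ, n₀, hn₀⟩ := h10 p hp5
    exact ⟨θ, hθ, n₀, fun n hn c y hy _ hF hFF hesc => hn₀ n hn c y hy hF hFF hesc⟩)
  intro p _ hp5
  obtain ⟨θ, hθ, n₀, hn₀⟩ := h p hp5
  exact ⟨θ, hθ, n₀, fun n hn c y hy hF hesc => hn₀ n hn c y hy trivial hF hesc⟩

omit hp in
/-- ★ LOW-RESIDUAL-FAR gives LOW-RESIDUAL-LOG, every schedule `B`. -/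
theorem lowResidualLog_of_lowResidualFar (B : ℕ → ℕ) : TowerDefs.LowResidualFarSide B → TowerDefs.LowResidualLogSide B :=
  fun h10 => absorb_farLog (fun _ n y => TowerDefs.LowVar B n y) h10

omit hp in
/-- ★ RESIDUAL-HIGH-FAR gives RESIDUAL-HIGH-LOG, every schedule `B`. -/
theorem residualHighLog_of_residualHighFar (B : ℕ → ℕ) :
    TowerDefs.ResidualHighFarSide B → TowerDefs.ResidualHighLogSide B :=
  fun h10 => absorb_farLog (fun _ n y => ¬ TowerDefs.LowVar B n y) h10

omit hp in
/-- ★★ RESIDUAL-LOG ⟺ RESIDUAL-FAR. -/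
theorem residualLog_iff_residualFar : TowerDefs.ResidualLogSide ↔ TowerDefs.ResidualFarSide :=
  ⟨residualFar_of_residualLog, residualLog_of_residualFar⟩

omit hp in
/-- ★★ LOW-RESIDUAL-LOG ⟺ LOW-RESIDUAL-FAR, every schedule `B`. -/
theorem lowResidualLog_iff_lowResidualFar (B : ℕ → ℕ) :
    TowerDefs.LowResidualLogSide B ↔ TowerDefs.LowResidualFarSide B :=
  ⟨lowResidualFar_of_lowResidualLog B, lowResidualLog_of_lowResidualFar B⟩

omit hp in
/-- ★★ RESIDUAL-HIGH-LOG ⟺ RESIDUAL-HIGH-FAR, every schedule `B`. -/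
theorem residualHighLog_iff_residualHighFar (B : ℕ → ℕ) :
    TowerDefs.ResidualHighLogSide B ↔ TowerDefs.ResidualHighFarSide B :=
  ⟨residualHighFar_of_residualHighLog B, residualHighLog_of_residualHighFar B⟩

omit hp in
/-- ★ RESIDUAL⁵ ⟺ RESIDUAL-FAR. -/
theorem residual5_iff_residualFar : TowerDefs.Residual5Side ↔ TowerDefs.ResidualFarSide :=
  residual5_iff_residualLog.trans residualLog_iff_residualFar

end FarPieces

/-! ### (3) the far split of T, by name -/

/-- ★★ **the DECIDING THEOREM of the far split** (item vocabulary): LOW-RESIDUAL-FAR ∧ RESIDUAL-HIGH-FAR at schedule `dialB`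
close `T`. -/
theorem closes_splitFar (hL : TowerDefs.LowResidualFarSide TowerDefs.dialB)
    (hH : TowerDefs.ResidualHighFarSide TowerDefs.dialB) :
    Summit.QuantumAdvantage.QuantumAdvantage.Theses.CharDial.WalkHardFJLinOdd :=
  closes_splitLog (lowResidualLog_of_lowResidualFar TowerDefs.dialB hL) (residualHighLog_of_residualHighFar TowerDefs.dialB hH)

/-- ★★ conversely `T` gives both far pieces. -/
theorem splitFar_of_closes (hT : Summit.QuantumAdvantage.QuantumAdvantage.Theses.CharDial.WalkHardFJLinOdd) :
    TowerDefs.LowResidualFarSide TowerDefs.dialB ∧ TowerDefs.ResidualHighFarSide TowerDefs.dialB :=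
  let ⟨hL, hH⟩ := splitLog_of_closes hT
  ⟨lowResidualFar_of_lowResidualLog _ hL, residualHighFar_of_residualHighLog _ hH⟩

/-- ★★ `T ⟺ LOW-RESIDUAL-FAR(dialB) ∧ RESIDUAL-HIGH-FAR(dialB)`. -/
theorem walkHardFJLinOdd_iff_residualFar_split :
    Summit.QuantumAdvantage.QuantumAdvantage.Theses.CharDial.WalkHardFJLinOdd ↔
      (TowerDefs.LowResidualFarSide TowerDefs.dialB ∧ TowerDefs.ResidualHighFarSide TowerDefs.dialB) :=
  ⟨splitFar_of_closes, fun h => closes_splitFar h.1 h.2⟩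

/-- ★★ `T ⟺ RESIDUAL-FAR` (both flip dials at budget `dialB n` absorbed, no variation split). -/
theorem walkHardFJLinOdd_iff_residualFar :
    Summit.QuantumAdvantage.QuantumAdvantage.Theses.CharDial.WalkHardFJLinOdd ↔ TowerDefs.ResidualFarSide :=
  walkHardFJLinOdd_iff_residualLog.trans residualLog_iff_residualFar

/-- ★ the filed LOW piece (item 27206) ⟺ LOW-RESIDUAL-FAR(dialB), by name. -/
theorem jlinLowResidual5_iff_lowResidualFar :
    Summit.QuantumAdvantage.QuantumAdvantage.Theses.CharDial.JLinLowResidual5 ↔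
      TowerDefs.LowResidualFarSide TowerDefs.dialB :=
  jlinLowResidual5_iff_lowResidualLog.trans (lowResidualLog_iff_lowResidualFar TowerDefs.dialB)

/-- ★ the filed HIGH residual (item 27207) ⟺ RESIDUAL-HIGH-FAR(dialB), by name. -/
theorem jlinResidualHigh5_iff_residualHighFar :
    Summit.QuantumAdvantage.QuantumAdvantage.Theses.CharDial.JLinResidualHigh5 ↔
      TowerDefs.ResidualHighFarSide TowerDefs.dialB :=
  jlinResidualHigh5_iff_residualHighLog.trans (residualHighLog_iff_residualHighFar TowerDefs.dialB)

/-! ### (4) the RESIDUAL-HIGH-FAR class is inhabited: `fieldY` has more than `dialB n` moving cuts at every adjacency -/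

section EscapeFar

variable {p : ℕ} [hp : Fact p.Prime]

/-- **`fieldY` escapes the far flip dial with `K` reacting cuts** (any window `w`, any threshold `L`) whenever `K + 1` full-pattern cuts
per column fit: at an adjacent pair some column jumps and its `K+1` cuts are NOT swap-stable, so no set of `≤ K` cuts leaves the rest
swap-stable.  A statement about the strategy `fieldY` alone. -/
theorem field_not_farFlip (n K w L Kb : ℕ) (hbig : p * (NullDial.sepM p n + (FieldCol.rk n + 1) * (Kb + 2)) ≤ n + 1)
    (hK : K + 1 ≤ Kb) (α : GaloisField p (FieldCol.rk n)) (h0 : α ≠ 0) (h1 : α ≠ 1) :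
    ¬ TowerDefs.FarFlipHyp p K w L (FieldCol.fieldY p n α) := by
  classical
  haveI : NeZero p := ⟨hp.out.ne_zero⟩
  rintro ⟨s, t, hst, G, hGK, -, -, -, -, -, hS, -⟩
  obtain ⟨r, hr⟩ := FieldCol.exists_col_jump p n α h0 h1 s t hst
  have hts : t ≠ s := fun h => by rw [h] at hst; omega
  set u₀ : Fin n → Bool := fun i => decide (i = s) with hu₀
  have hne : u₀ s ≠ u₀ t := by rw [hu₀]; simp [hts]
  set c₀ : Fin p := ⟨(form (FieldCol.col p n α r) u₀).val, ZMod.val_lt _⟩ with hc₀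
  have hcu : ((c₀.val : ℕ) : ZMod p) = form (FieldCol.col p n α r) u₀ := ZMod.natCast_zmod_val _
  set f : Fin (K + 1) → Fin (n + 1) := fun k => FieldCol.cutAt p n Kb hbig r ⟨k.val, lt_of_lt_of_le k.isLt hK⟩ c₀ with hf0
  have hf : Function.Injective f := by
    intro k k' hkk
    have h := FieldCol.cutAt_injective p n Kb hbig r c₀ hkk
    exact Fin.ext (by simpa using congrArg Fin.val h)
  have hmem : ∀ k, f k ∈ G := by
    intro k
    by_contra hk
    exact FieldCol.fieldY_flip p n Kb hbig α r _ c₀ u₀ s t hst hne hr hcu (hS (f k) hk u₀ hne)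
  have h1c : (univ.image f).card = K + 1 := by rw [card_image_of_injective _ hf, card_univ, Fintype.card_fin]
  have h2c : univ.image f ⊆ G := fun g hg => by
    obtain ⟨k, -, rfl⟩ := mem_image.1 hg
    exact hmem k
  have h3c := card_le_card h2c
  omega

/-- ★★★ **`fieldY` in class(RESIDUAL-HIGH-FAR), eventually** (every prime `p ≥ 5`): JLin-presentable, HIGH at `dialB`, outside both
flip dials at budget `dialB n` (it has `2·dialB n + 1 > dialB n` full-pattern cuts per column, all moving at every adjacency), and in
EVERY `log₂ n`-junta presentation outside the rank, sparse, block, null and mask dials. -/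
theorem fieldY_classFar_eventually (hp5 : 5 ≤ p) : ∃ n₀ : ℕ, ∀ n ≥ n₀, ∃ α : GaloisField p (FieldCol.rk n),
    TowerDefs.JLinHyp p n (FieldCol.fieldY p n α) ∧ ¬ TowerDefs.LowVar TowerDefs.dialB n (FieldCol.fieldY p n α) ∧
    ¬ TowerDefs.FlipHyp p (TowerDefs.dialB n) (TowerDefs.dialB n) (FieldCol.fieldY p n α) ∧
    ¬ TowerDefs.FarFlipHyp p (TowerDefs.dialB n) (TowerDefs.dialB n) (TowerDefs.farL n) (FieldCol.fieldY p n α) ∧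
    ∀ D : JLinPeel.JLinData p n, D.strat = FieldCol.fieldY p n α → (∀ g, (D.J g).card ≤ Nat.log 2 n) →
      ¬ TowerDefs.SpanHyp D ∧ ¬ TowerDefs.SparseHyp D ∧ ¬ TowerDefs.BlockHyp D ∧ ¬ TowerDefs.NullHyp D ∧
        ¬ TowerDefs.MaskHyp D := by
  have hp3 : p % 3 = 1 ∨ p % 3 = 2 := Tower.mod3_of_prime_ge5 hp.out hp5
  obtain ⟨n₁, hn₁⟩ := FieldCol.eventually_fits p
  obtain ⟨n₂, hn₂⟩ := FieldCol.eventually_big p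
  obtain ⟨n₃, hn₃⟩ := FieldCol.eventually_misc p
  obtain ⟨n₄, hn₄⟩ := FieldCol.field_not_span_eventually p
  refine ⟨max (max n₁ n₂) (max n₃ n₄), fun n hn => ?_⟩
  have hfit := hn₁ n (le_trans (le_trans (le_max_left _ _) (le_max_left _ _)) hn)
  have hbig := hn₂ n (le_trans (le_trans (le_max_right _ _) (le_max_left _ _)) hn)
  obtain ⟨hpL, hpn, hn9⟩ := hn₃ n (le_trans (le_trans (le_max_left _ _) (le_max_right _ _)) hn)
  have hspan := hn₄ n (le_trans (le_trans (le_max_right _ _) (le_max_right _ _)) hn)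
  obtain ⟨α, hα⟩ := FieldCol.exists_generic p n (by omega)
  have h0 : α ≠ 0 := FieldCol.generic_ne_zero p n (by omega) α hα
  have h1 : α ≠ 1 := FieldCol.generic_ne_one p n hpL hpn α hα
  have hL2 : 2 ≤ Nat.log 2 n := le_trans (by omega) hpL
  have hK : TowerDefs.dialB n + 1 ≤ 2 * (4 * (Nat.log 2 n + 1)) + 1 := by unfold TowerDefs.dialB; omega
  refine ⟨α, ?_, FieldCol.not_low_fieldY p n _ hbig le_rfl (by omega) α h0 h1,
    field_not_flip n (TowerDefs.dialB n) (TowerDefs.dialB n) _ hbig hK α h0 h1,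
    field_not_farFlip n (TowerDefs.dialB n) (TowerDefs.dialB n) (TowerDefs.farL n) _ hbig hK α h0 h1, fun D hD hJ => ?_⟩
  · intro g
    exact ⟨∅, by simp, (FieldCol.fieldData p n α).a g, (FieldCol.fieldData p n α).h g, fun _ _ _ _ => rfl, fun u => rfl⟩
  · have hM : ¬ TowerDefs.MaskHyp D := (Tower.maskHyp_iff_inlined D).not.mpr (FieldCol.field_not_mask p n hfit α hα D hD hJ)
    exact ⟨(Tower.spanHyp_iff_inlined D).not.mpr (hspan α D hD hJ),
      (Tower.sparseHyp_iff_inlined D).not.mpr (FieldCol.field_not_sparse p n hfit hL2 α D hD),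
      fun hB => hM (Tower.maskHyp_of_blockHyp hp3 D hB), fun hN => hM (Tower.maskHyp_of_nullHyp D hN), hM⟩

/-- ★★★ **class(RESIDUAL-HIGH-FAR) IS INHABITED** (item vocabulary): for every prime `p ≥ 5` and all large `n` some strategy satisfies
the JLin hypothesis, is HIGH at `dialB`, escapes both flip dials at budget `dialB n`, and escapes the five decided presentation-level
dials in every `log₂ n`-junta ⊕ one-form presentation. -/
theorem residualHighFar_class_inhabited (p : ℕ) [Fact p.Prime] (hp5 : 5 ≤ p) :
    ∃ n₁ : ℕ, ∀ n ≥ n₁, ∃ y : Fin (n + 1) → (Fin n → Bool) → Bool,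
      TowerDefs.JLinHyp p n y ∧ ¬ TowerDefs.LowVar TowerDefs.dialB n y ∧
      ¬ TowerDefs.FlipHyp p (TowerDefs.dialB n) (TowerDefs.dialB n) y ∧
      ¬ TowerDefs.FarFlipHyp p (TowerDefs.dialB n) (TowerDefs.dialB n) (TowerDefs.farL n) y ∧
      ∀ D : JLinPeel.JLinData p n, D.strat = y → (∀ g, (D.J g).card ≤ Nat.log 2 n) →
        ¬ TowerDefs.SpanHyp D ∧ ¬ TowerDefs.SparseHyp D ∧ ¬ TowerDefs.BlockHyp D ∧ ¬ TowerDefs.NullHyp D ∧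
          ¬ TowerDefs.MaskHyp D := by
  obtain ⟨n₀, h⟩ := fieldY_classFar_eventually (p := p) hp5
  exact ⟨n₀, fun n hn => let ⟨α, hy, hV, hF, hFF, hesc⟩ := h n hn; ⟨FieldCol.fieldY p n α, hy, hV, hF, hFF, hesc⟩⟩

/-- ★ **RESIDUAL-HIGH-FAR is tested NON-VACUOUSLY**: a purported `ResidualHighFarSide dialB` bound applies to an actual member of its
class. -/
theorem residualHighFar_nonvacuous (hR : TowerDefs.ResidualHighFarSide TowerDefs.dialB) (p : ℕ) [Fact p.Prime] (hp5 : 5 ≤ p) :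
    ∃ θ : ℝ, θ < 1 ∧ ∃ n₀ : ℕ, ∀ n ≥ n₀, ∃ y : Fin (n + 1) → (Fin n → Bool) → Bool,
      TowerDefs.JLinHyp p n y ∧ ¬ TowerDefs.LowVar TowerDefs.dialB n y ∧ ∀ c : ℕ,
        ((Finset.univ.filter fun u : Fin n → Bool => ringWinU c y u = true).card : ℝ) ≤ θ * (2 : ℝ) ^ n := by
  obtain ⟨θ, hθ, n₀, h⟩ := hR p hp5
  obtain ⟨n₁, h₁⟩ := residualHighFar_class_inhabited p hp5
  refine ⟨θ, hθ, max n₀ n₁, fun n hn => ?_⟩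
  obtain ⟨y, hy, hV, hF, hFF, hesc⟩ := h₁ n (le_trans (le_max_right _ _) hn)
  exact ⟨y, hy, hV, fun c => h n (le_trans (le_max_left _ _) hn) c y hy hV hF hFF hesc⟩

end EscapeFar

end TokenDial

end Summit.QuantumAdvantage.AdviceFreeQNC0.JLinPeel
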